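import Literature.Computability.AlgebraicComplexity.IK20HighestWeightVectors
import Mathlib.Data.Fintype.Sum
import HarnessLib

/-!
# Ikenmeyer–Kandasamy 2020, Thm. 13.1 (Tableau Lifting Theorem): the alphabet and the transport plumbing

References: C. Ikenmeyer, U. Kandasamy, "Implementing geometric complexity theory: on the
separation of orbit closures via symmetries", STOC 2020 / arXiv:1911.03990 (bib key
`IkenmeyerKandasamy2019`): §13 (TeX L1120–1200; chunk p0019–p0020 of the held text), §15 (chunk
p0021:L80–p0022) and §17 (chunk p0024).

This file is brick E1 of the multi-seat program for the named fact `IK2020_thm_13_1`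
(`AC/IK20HighestWeightVectors.lean`; route note `HOME/bip/NOTE-t08g4-IK2020Thm131-route.md`).
It introduces NO named fact: definitions with bodies and proved lemmas only (net debt 0).

## Contents

* §A API for `IK2020.ColTableau`: `relabel` is functorial; `IsRegular`, `count` and `IsDuplex`
  transport along an injective relabelling of the alphabet; the content of a relabelled tableau
  (`count_relabel`); the number of boxes (`sum_count`); duplexity of a rectangle
  (`isDuplex_rectTableau_iff`); extension of a partial injection of letters to a permutation
  (`exists_perm_extend_of_injOn`, used for property (1) of Thm. 13.1, where `rightpart(φT) = φ°S`
  with `φ°` injective on the letters occurring in `S`, §17 Claim 30).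
* §B `IK2020.LiftingWitness D S L R`: the three conclusions of Thm. 13.1 for a candidate pair
  (`L` = leftpart, `R` = rightpart of the shape of `S`) over an ARBITRARY alphabet `α`.
  `IK2020_thm_13_1` says verbatim that a witness over the alphabet `Fin δ` exists
  (`IK2020_thm_13_1_iff`); a witness transports along any bijection of alphabets
  (`LiftingWitness.map_equiv`), so a witness over any finite alphabet of cardinality `δ` suffices
  (`IK2020_thm_13_1_of_forall_exists_witness`). This is exactly how the printed proof argues
  (§13, TeX L1196–1199; chunk p0020.txt:L22: "the alphabet that we are using for `T` is not
  `{1,…,δ}`, but a more descriptive alphabet using the symbols `i_ℓ` and `j_k^i`").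
* §C the descriptive alphabet `IK2020.LiftSym m n ϱ` of §15 / §19: the NAME symbols `i_ℓ`
  (`ℓ < n_i + ϱ_i` = the number of name edges of the `(D, ϱ_i)`-hypergraph `H^{(i)}` with `n_i`
  block edges, Def. 14.1 (5)) and the BLOCK symbols `j_k^i` (`k < n_i`, `j ≠ i`); its cardinality
  `m · (∑ n_i) + ∑ ϱ_i` (`card_liftSym`); the block-edge count `IK2020.blockCount D ϱ_i` of
  Props. 14.2 / 18.3 with `e_ϱ = ∑_i blockCount D ϱ_i` (`eRho_map_eq_sum`), whence
  `card (LiftSym m (blockCount D ∘ ϱ) ϱ) = m e_ϱ + d = δ` (`card_liftSym_blockCount`); the letter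
  map `LiftSym.base` (`i_ℓ ↦ i`, `j_k^i ↦ j`) of the proof of property (3) (§17, chunk
  p0024.txt:L16: "We choose `φ(i_ℓ) := i` and `φ(j_k^i) := j`").
* §D the degenerate corner `d = 0` of `IK2020_thm_13_1` (then `S` is empty, `e_ϱ = 0`, `δ = 0`
  and all three conclusions are vacuous), proved outright (`IK2020_thm_13_1_of_d_eq_zero`).
-/

namespace Literature.Computability.AlgebraicComplexity

open IK2020 Finset
open scoped BigOperators

namespace IK2020

/-! ## §A  `ColTableau` API: relabelling, content, regularity, duplexity -/

namespace ColTableau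

variable {α β γ : Type*}

/-- `φ(T)` has the columns of `T`. [cite: IkenmeyerKandasamy2019, §7] -/
@[simp] theorem relabel_C (φ : α → β) (T : ColTableau α) : (T.relabel φ).C = T.C := rfl

/-- `φ(T)` has the column heights of `T`. [cite: IkenmeyerKandasamy2019, §7] -/
@[simp] theorem relabel_h (φ : α → β) (T : ColTableau α) : (T.relabel φ).h = T.h := rfl

/-- The entries of `φ(T)`. [cite: IkenmeyerKandasamy2019, §7] -/
@[simp] theorem relabel_entry (φ : α → β) (T : ColTableau α) (c : Fin T.C) (r : Fin (T.h c)) :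
    (T.relabel φ).entry c r = φ (T.entry c r) := rfl

/-- `φ(mk C h e) = mk C h (φ ∘ e)`. [cite: IkenmeyerKandasamy2019, §7] -/
theorem mk_relabel (C : ℕ) (h : Fin C → ℕ) (e : (c : Fin C) → Fin (h c) → α) (φ : α → β) :
    (ColTableau.mk C h e).relabel φ = ColTableau.mk C h (fun c r => φ (e c r)) := rfl

/-- Relabelling by the identity. [cite: IkenmeyerKandasamy2019, §7] -/
@[simp] theorem relabel_id (T : ColTableau α) : T.relabel id = T := by
  cases T; rfl

/-- Relabelling by the identity permutation. [cite: IkenmeyerKandasamy2019, §7] -/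
@[simp] theorem relabel_perm_one (T : ColTableau α) : T.relabel ⇑(1 : Equiv.Perm α) = T := by
  cases T; rfl

/-- Relabelling is functorial: `ψ(φ(T)) = (ψ ∘ φ)(T)`. [cite: IkenmeyerKandasamy2019, §7] -/
theorem relabel_relabel (φ : α → β) (ψ : β → γ) (T : ColTableau α) :
    (T.relabel φ).relabel ψ = T.relabel (ψ ∘ φ) := rfl

/-- Two relabellings that agree on the entries of `T` give the same tableau.
[cite: IkenmeyerKandasamy2019, §7] -/
theorem relabel_congr {φ ψ : α → β} (T : ColTableau α)
    (h : ∀ c r, φ (T.entry c r) = ψ (T.entry c r)) : T.relabel φ = T.relabel ψ := by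
  simp only [relabel, mk.injEq, heq_eq_eq, true_and]
  funext c r
  exact h c r

/-- Regularity is reflected by every relabelling (`φ ∘ col` injective ⇒ `col` injective).
[cite: IkenmeyerKandasamy2019, §3] -/
theorem IsRegular.of_relabel {φ : α → β} {T : ColTableau α} (h : (T.relabel φ).IsRegular) :
    T.IsRegular :=
  fun c => Function.Injective.of_comp (f := φ) (h c)

/-- Regularity is invariant under an injective relabelling of the alphabet.
[cite: IkenmeyerKandasamy2019, §3] -/
theorem isRegular_relabel_iff {φ : α → β} (hφ : Function.Injective φ) (T : ColTableau α) :
    (T.relabel φ).IsRegular ↔ T.IsRegular :=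
  forall_congr' fun c => hφ.of_comp_iff (T.entry c)

/-- [cite: IkenmeyerKandasamy2019, §3] -/
theorem IsRegular.relabel {T : ColTableau α} (h : T.IsRegular) {φ : α → β}
    (hφ : Function.Injective φ) : (T.relabel φ).IsRegular :=
  (isRegular_relabel_iff hφ T).2 h

section count

variable [DecidableEq α] [DecidableEq β]

/-- The content of `mk C h e` at `a`, unfolded. [cite: IkenmeyerKandasamy2019, §3] -/
theorem count_mk (C : ℕ) (h : Fin C → ℕ) (e : (c : Fin C) → Fin (h c) → α) (a : α) :
    (ColTableau.mk C h e).count a = ∑ c, (univ.filter fun r => e c r = a).card := rfl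

/-- An injective relabelling preserves contents: `φ(T)` contains `φ a` as often as `T`
contains `a`. [cite: IkenmeyerKandasamy2019, §3] -/
theorem count_relabel_of_injective {φ : α → β} (hφ : Function.Injective φ) (T : ColTableau α)
    (a : α) : (T.relabel φ).count (φ a) = T.count a := by
  refine Finset.sum_congr rfl fun c _ => congrArg Finset.card (Finset.filter_congr fun r _ => ?_)
  exact hφ.eq_iff

omit [DecidableEq α] in
/-- Symbols outside the range of the relabelling do not occur in `φ(T)`.
[cite: IkenmeyerKandasamy2019, §3] -/
theorem count_relabel_eq_zero {φ : α → β} (T : ColTableau α) {b : β} (hb : ∀ a, φ a ≠ b) :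
    (T.relabel φ).count b = 0 := by
  refine Finset.sum_eq_zero fun c _ => ?_
  rw [Finset.card_eq_zero, Finset.filter_eq_empty_iff]
  exact fun r _ => hb _

/-- The content of a relabelled tableau: `φ(T)` contains `b` as often as `T` contains some
preimage of `b`. [cite: IkenmeyerKandasamy2019, §7] -/
theorem count_relabel [Fintype α] (φ : α → β) (T : ColTableau α) (b : β) :
    (T.relabel φ).count b = ∑ a ∈ univ.filter (fun a => φ a = b), T.count a := by
  simp only [count, relabel]
  rw [Finset.sum_comm]
  refine Finset.sum_congr rfl fun c _ => ?_
  rw [Finset.card_eq_sum_card_fiberwise (f := T.entry c) (t := univ.filter fun a => φ a = b)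
    (fun r hr => by simpa using hr)]
  refine Finset.sum_congr rfl fun a ha => ?_
  simp only [Finset.mem_filter, Finset.mem_univ, true_and] at ha
  congr 1
  ext r
  simp only [Finset.mem_filter, Finset.mem_univ, true_and, and_iff_right_iff_imp]
  rintro rfl
  exact ha

/-- A symbol does not occur iff its content is zero. [cite: IkenmeyerKandasamy2019, §3] -/
theorem count_eq_zero_iff (T : ColTableau α) (a : α) :
    T.count a = 0 ↔ ∀ c r, T.entry c r ≠ a := by
  simp [count, Finset.sum_eq_zero_iff, Finset.filter_eq_empty_iff]

/-- The total content is the number of boxes. [cite: IkenmeyerKandasamy2019, §3] -/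
theorem sum_count [Fintype α] (T : ColTableau α) : ∑ a, T.count a = ∑ c, T.h c := by
  simp only [count]
  rw [Finset.sum_comm]
  refine Finset.sum_congr rfl fun c _ => ?_
  rw [← Finset.card_eq_sum_card_fiberwise fun r _ => Finset.mem_univ (T.entry c r)]
  simp

/-- Duplexity is invariant under an injective relabelling of the alphabet (columns of `φ(T)`
coincide iff the corresponding columns of `T` do). [cite: IkenmeyerKandasamy2019, §3] -/
theorem isDuplex_relabel_iff {φ : α → β} (hφ : Function.Injective φ) (T : ColTableau α) :
    (T.relabel φ).IsDuplex ↔ T.IsDuplex := by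
  refine forall_congr' fun c => ?_
  refine iff_of_eq (congrArg Even (congrArg Finset.card (Finset.filter_congr fun c' _ => ?_)))
  exact exists_congr fun e => forall_congr' fun r => hφ.eq_iff

end count

/-- A tableau with `0` boxes in the sense of `IsShape m 0` has no columns (all column heights
are positive). [cite: IkenmeyerKandasamy2019, §3] -/
theorem C_eq_zero_of_isShape_zero {T : ColTableau α} {m : ℕ} (h : T.IsShape m 0) : T.C = 0 := by
  obtain ⟨-, hpos, hsum⟩ := h
  by_contra hC
  have : 0 < ∑ c, T.h c :=
    Finset.sum_pos (fun c _ => (hpos c).1) ⟨⟨0, Nat.pos_of_ne_zero hC⟩, Finset.mem_univ _⟩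
  omega

/-- The number of boxes of a tableau of shape `λ ⊢_m n` is `n`. [cite: IkenmeyerKandasamy2019, §3] -/
theorem sum_count_eq_of_isShape [Fintype α] [DecidableEq α] {T : ColTableau α} {m n : ℕ}
    (h : T.IsShape m n) : ∑ a, T.count a = n := by
  rw [sum_count, h.2.2]

end ColTableau

/-! ### Rectangles (`leftpart`) -/

section rect

variable {α β : Type*} {m E : ℕ}

/-- `leftpart` has `E` columns. [cite: IkenmeyerKandasamy2019, §13] -/
@[simp] theorem rectTableau_C (L : Fin E → Fin m → α) : (rectTableau L).C = E := rfl

/-- `leftpart` has columns of height `m`. [cite: IkenmeyerKandasamy2019, §13] -/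
@[simp] theorem rectTableau_h (L : Fin E → Fin m → α) (c : Fin E) : (rectTableau L).h c = m := rfl

/-- The entries of `leftpart`. [cite: IkenmeyerKandasamy2019, §13] -/
@[simp] theorem rectTableau_entry (L : Fin E → Fin m → α) (c : Fin E) (r : Fin m) :
    (rectTableau L).entry c r = L c r := rfl

/-- `φ(leftpart)` is the rectangle with entries `φ ∘ L`. [cite: IkenmeyerKandasamy2019, §13] -/
theorem rectTableau_relabel (L : Fin E → Fin m → α) (φ : α → β) :
    (rectTableau L).relabel φ = rectTableau (fun c r => φ (L c r)) := rfl

/-- A rectangle is regular iff each of its columns is injective. [cite: IkenmeyerKandasamy2019, §3] -/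
theorem isRegular_rectTableau_iff (L : Fin E → Fin m → α) :
    (rectTableau L).IsRegular ↔ ∀ c, Function.Injective (L c) := Iff.rfl

/-- The content of a rectangle, unfolded. [cite: IkenmeyerKandasamy2019, §3] -/
theorem count_rectTableau [DecidableEq α] (L : Fin E → Fin m → α) (a : α) :
    (rectTableau L).count a = ∑ c : Fin E, (univ.filter fun r : Fin m => L c r = a).card := rfl

/-- **Duplexity of a rectangle**: all columns have the same height, so `leftpart` is duplex iff
every column (as a function `Fin m → α`) occurs an even number of times. (Route-note pitfall:
`ColTableau.IsDuplex` compares columns as (height, entries) through a `Fin.cast`.)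
[cite: IkenmeyerKandasamy2019, §3] -/
theorem isDuplex_rectTableau_iff [DecidableEq α] (L : Fin E → Fin m → α) :
    (rectTableau L).IsDuplex ↔
      ∀ c : Fin E, Even ((univ.filter fun c' : Fin E => L c' = L c).card) := by
  refine forall_congr' fun c => ?_
  refine iff_of_eq (congrArg Even (congrArg Finset.card (Finset.filter_congr fun c' _ => ?_)))
  exact ⟨fun ⟨_, h⟩ => funext fun r => h r, fun h => ⟨rfl, fun r => congrFun h r⟩⟩

end rect

/-! ### Extending a partial injection of letters to a permutation (for property (1)) -/

/-- A map `f : Fin m → Fin m` that is injective on a set `s` of letters agrees on `s` with a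
permutation of `Fin m` (used in §17: `φ°` is injective on `I`, Claim 30, and letters outside `I`
do not occur in `S`, so `φ°S = πS` for a permutation `π`). [cite: IkenmeyerKandasamy2019, §17] -/
theorem exists_perm_extend_of_injOn {m : ℕ} (s : Finset (Fin m)) (f : Fin m → Fin m)
    (hf : Set.InjOn f s) : ∃ π : Equiv.Perm (Fin m), ∀ i ∈ s, π i = f i := by
  classical
  obtain ⟨g, hg⟩ := Finset.exists_equiv_extend_of_card_eq (α := Fin m) (t := Finset.univ)
    (by simp) (s := s) (f := f) (by simp) hf
  refine ⟨g.trans (Equiv.subtypeUnivEquiv Finset.mem_univ), fun i hi => ?_⟩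
  simp [← hg i hi]

/-! ## §B  The conclusion of Thm. 13.1 over an arbitrary alphabet, and its transport -/

/-- **The three conclusions of the Tableau Lifting Theorem for a candidate lifted tableau.**
For `S : ColTableau (Fin m)` (the given regular tableau of shape `λ ⊢_m dD`), a leftpart
`L : Fin E → Fin m → α` (`E` columns of height `m`) and a rightpart `R` of the shape of `S`, both
over an alphabet `α` (Thm. 13.1, TeX L1128–1144; chunk p0019.txt:L11–28): (count) "every entry
appears exactly `D` many times"; (1)+(2) "for each `φ ∈ ℳ_{δ,m}` for which `φ(T)` is regular we
have that `rightpart(φ(T)) ∈ 𝔖_m S`" and "`leftpart(φ(T))` is duplex"; (3) "there exists `φ` such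
that `φ(T)` is regular and `rightpart(φ(T)) = S`". With `α = Fin δ` this is VERBATIM the body of the
named fact `IK2020_thm_13_1` (`IK2020_thm_13_1_iff`); the printed proof works over the descriptive
alphabet `LiftSym` instead (§13, chunk p0020.txt:L22) and transports (`LiftingWitness.map_equiv`).
[cite: IkenmeyerKandasamy2019, Thm. 13.1] -/
structure LiftingWitness (D : ℕ) {m : ℕ} (S : ColTableau (Fin m)) {α : Type*} [DecidableEq α]
    {E : ℕ} (L : Fin E → Fin m → α) (R : (c : Fin S.C) → Fin (S.h c) → α) : Prop where
  /-- every symbol occurs exactly `D` times in `T = leftpart + rightpart` -/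
  count_eq : ∀ u : α, (rectTableau L).count u + (ColTableau.mk S.C S.h R).count u = D
  /-- properties (1) and (2): for every `φ` with `φ(T)` regular, `rightpart(φT) ∈ 𝔖_m S` and
  `leftpart(φT)` is duplex -/
  of_regular : ∀ φ : α → Fin m,
    (rectTableau fun c r => φ (L c r)).IsRegular →
    ((ColTableau.mk S.C S.h R).relabel φ).IsRegular →
      (∃ π : Equiv.Perm (Fin m), (ColTableau.mk S.C S.h R).relabel φ = S.relabel π) ∧
      (rectTableau fun c r => φ (L c r)).IsDuplex
  /-- property (3): some `φ` makes `φ(T)` regular with `rightpart(φT) = S` -/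
  exists_regular : ∃ φ : α → Fin m,
    (rectTableau fun c r => φ (L c r)).IsRegular ∧
    ((ColTableau.mk S.C S.h R).relabel φ).IsRegular ∧
    (ColTableau.mk S.C S.h R).relabel φ = S

/-- [cite: IkenmeyerKandasamy2019, Thm. 13.1] -/
theorem liftingWitness_iff (D : ℕ) {m : ℕ} (S : ColTableau (Fin m)) {α : Type*} [DecidableEq α]
    {E : ℕ} (L : Fin E → Fin m → α) (R : (c : Fin S.C) → Fin (S.h c) → α) :
    LiftingWitness D S L R ↔
      (∀ u : α, (rectTableau L).count u + (ColTableau.mk S.C S.h R).count u = D) ∧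
      (∀ φ : α → Fin m,
        (rectTableau fun c r => φ (L c r)).IsRegular →
        ((ColTableau.mk S.C S.h R).relabel φ).IsRegular →
          (∃ π : Equiv.Perm (Fin m), (ColTableau.mk S.C S.h R).relabel φ = S.relabel π) ∧
          (rectTableau fun c r => φ (L c r)).IsDuplex) ∧
      (∃ φ : α → Fin m,
        (rectTableau fun c r => φ (L c r)).IsRegular ∧
        ((ColTableau.mk S.C S.h R).relabel φ).IsRegular ∧
        (ColTableau.mk S.C S.h R).relabel φ = S) :=
  ⟨fun ⟨h₁, h₂, h₃⟩ => ⟨h₁, h₂, h₃⟩, fun ⟨h₁, h₂, h₃⟩ => ⟨h₁, h₂, h₃⟩⟩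

end IK2020

/-- **`IK2020_thm_13_1` unfolded**: the Tableau Lifting Theorem asserts a `LiftingWitness` over
the alphabet `Fin δ`, `δ = m e_ϱ + d`, with `E = e_ϱ D` left columns.
[cite: IkenmeyerKandasamy2019, Thm. 13.1] -/
theorem IK2020_thm_13_1_iff :
    IK2020_thm_13_1 ↔
    ∀ (D m d : ℕ), 3 ≤ D → 2 ≤ m → (Odd D → 2 * (m - 1) ≤ Nat.choose (2 * (D - 1)) (D - 1)) →
    ∀ (S : ColTableau (Fin m)), S.IsShape m (d * D) → S.IsRegular →
    ∀ (ρ : Fin m → ℕ), Antitone ρ → ∑ i, ρ i = d → (∀ i, S.count i = D * ρ i) →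
      ∃ (L : Fin (eRho D (Finset.univ.val.map ρ) * D) → Fin m →
          Fin (m * eRho D (Finset.univ.val.map ρ) + d))
        (R : (c : Fin S.C) → Fin (S.h c) → Fin (m * eRho D (Finset.univ.val.map ρ) + d)),
        LiftingWitness D S L R := by
  simp only [IK2020_thm_13_1, liftingWitness_iff]

namespace IK2020

namespace LiftingWitness

variable {D m E : ℕ} {S : ColTableau (Fin m)} {α β : Type*} [DecidableEq α] [DecidableEq β]
  {L : Fin E → Fin m → α} {R : (c : Fin S.C) → Fin (S.h c) → α}

/-- **Transport of a lifting witness along a bijection of alphabets** (`T ↦ e(T)`): contents are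
preserved, the maps `φ : β → [m]` correspond to the maps `φ ∘ e : α → [m]` with literally the same
`φ(T)`, and the regular `φ` of property (3) becomes `φ ∘ e⁻¹`. This is the (implicit) step "the
alphabet that we are using for `T` is not `{1,…,δ}`, but a more descriptive alphabet" of §13.
[cite: IkenmeyerKandasamy2019, §13] -/
theorem map_equiv (h : LiftingWitness D S L R) (e : α ≃ β) :
    LiftingWitness D S (fun c r => e (L c r)) (fun c r => e (R c r)) := by
  obtain ⟨h₁, h₂, φ, hφL, hφR, hφS⟩ := h
  refine ⟨fun u => ?_, fun ψ hL hR => h₂ (ψ ∘ e) hL hR, ⟨φ ∘ e.symm, ?_, ?_, ?_⟩⟩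
  · obtain ⟨a, rfl⟩ := e.surjective u
    have hL' : (rectTableau fun c r => e (L c r)) = (rectTableau L).relabel e := rfl
    have hR' : (ColTableau.mk S.C S.h fun c r => e (R c r)) =
        (ColTableau.mk S.C S.h R).relabel e := rfl
    rw [hL', hR', ColTableau.count_relabel_of_injective e.injective,
      ColTableau.count_relabel_of_injective e.injective]
    exact h₁ a
  · simpa only [Function.comp_apply, Equiv.symm_apply_apply] using hφL
  · have hc : (φ ∘ e.symm) ∘ e = φ := funext fun a => by simp
    show (((ColTableau.mk S.C S.h R).relabel e).relabel (φ ∘ e.symm)).IsRegular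
    rw [ColTableau.relabel_relabel, hc]
    exact hφR
  · have hc : (φ ∘ e.symm) ∘ e = φ := funext fun a => by simp
    show ((ColTableau.mk S.C S.h R).relabel e).relabel (φ ∘ e.symm) = S
    rw [ColTableau.relabel_relabel, hc]
    exact hφS

/-- A witness over any finite alphabet with `δ` symbols yields a witness over `Fin δ` (the
alphabet of the named fact). [cite: IkenmeyerKandasamy2019, §13] -/
theorem exists_fin [Fintype α] (h : LiftingWitness D S L R) {δ : ℕ} (hδ : Fintype.card α = δ) :
    ∃ (L' : Fin E → Fin m → Fin δ) (R' : (c : Fin S.C) → Fin (S.h c) → Fin δ),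
      LiftingWitness D S L' R' :=
  ⟨_, _, h.map_equiv (Fintype.equivFinOfCardEq hδ)⟩

/-- **The degenerate case of an empty alphabet** (`δ = 0`, which happens iff `d = 0`): if `S`
has no columns then every candidate pair over an empty alphabet is a witness, all three
conclusions being vacuous (`m ≥ 1` makes a column of `leftpart` impossible).
[cite: IkenmeyerKandasamy2019, Thm. 13.1] -/
theorem of_isEmpty [IsEmpty α] (hm : 0 < m) (hS : S.C = 0) (L : Fin E → Fin m → α)
    (R : (c : Fin S.C) → Fin (S.h c) → α) : LiftingWitness D S L R := by
  have hL : ∀ c : Fin E, False := fun c => isEmptyElim (L c ⟨0, hm⟩)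
  have hC : ∀ c : Fin S.C, False := fun c => (Fin.cast hS c).elim0
  refine ⟨fun u => isEmptyElim u, fun ψ _ _ => ⟨⟨1, ?_⟩, fun c => (hL c).elim⟩,
    ⟨fun u => isEmptyElim u, fun c => (hL c).elim, fun c => (hC c).elim, ?_⟩⟩
  · simp only [ColTableau.relabel, ColTableau.mk.injEq, heq_eq_eq, true_and]
    funext c
    exact (hC c).elim
  · obtain ⟨C, h, e⟩ := S
    simp only [ColTableau.relabel, ColTableau.mk.injEq, heq_eq_eq, true_and]
    funext c
    exact (hC c).elim

end LiftingWitness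

end IK2020

/-- **Successor interface.** To prove `IK2020_thm_13_1` it suffices to produce, for all data of
the theorem, a `LiftingWitness` over SOME finite alphabet with exactly `δ = m e_ϱ + d` symbols
(e.g. `IK2020.LiftSym`, §C); the passage to `Fin δ` is `LiftingWitness.exists_fin`.
[cite: IkenmeyerKandasamy2019, §13] -/
theorem IK2020_thm_13_1_of_forall_exists_witness
    (H : ∀ (D m d : ℕ), 3 ≤ D → 2 ≤ m →
      (Odd D → 2 * (m - 1) ≤ Nat.choose (2 * (D - 1)) (D - 1)) →
      ∀ (S : ColTableau (Fin m)), S.IsShape m (d * D) → S.IsRegular →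
      ∀ (ρ : Fin m → ℕ), Antitone ρ → ∑ i, ρ i = d → (∀ i, S.count i = D * ρ i) →
        ∃ (α : Type) (_ : Fintype α) (_ : DecidableEq α)
          (L : Fin (eRho D (Finset.univ.val.map ρ) * D) → Fin m → α)
          (R : (c : Fin S.C) → Fin (S.h c) → α),
          Fintype.card α = m * eRho D (Finset.univ.val.map ρ) + d ∧ LiftingWitness D S L R) :
    IK2020_thm_13_1 := by
  rw [IK2020_thm_13_1_iff]
  intro D m d hD hm hodd S hS hreg ρ hρ hsum hcnt
  obtain ⟨α, _, _, L, R, hcard, hW⟩ := H D m d hD hm hodd S hS hreg ρ hρ hsum hcnt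
  exact hW.exists_fin hcard

namespace IK2020

/-! ## §C  The descriptive alphabet `i_ℓ`, `j_k^i` -/

/-- **The number of block edges of the hypergraph `H^{(i)}` attached to a letter `i` with
`ϱ_i = r`**: `⌈r/(D-2)⌉` for even `D` (Prop. 14.2, TeX L1705–1707) and `2⌈r/(2(D-2))⌉` for odd
`D` (Prop. 18.3, TeX L2971–2973); summed over `i` this is `e_ϱ` (`eRho_eq_sum_blockCount`).
[cite: IkenmeyerKandasamy2019, Thm. 13.1] -/
def blockCount (D r : ℕ) : ℕ :=
  if Even D then ceilDiv r (D - 2) else 2 * ceilDiv r (2 * (D - 2))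

/-- Even `D`: `⌈r/(D-2)⌉` block edges (Prop. 14.2). [cite: IkenmeyerKandasamy2019, Prop. 14.2] -/
theorem blockCount_of_even {D : ℕ} (hD : Even D) (r : ℕ) : blockCount D r = ceilDiv r (D - 2) :=
  if_pos hD

/-- Odd `D`: `2⌈r/(2(D-2))⌉` block edges (Prop. 18.3). [cite: IkenmeyerKandasamy2019, Prop. 18.3] -/
theorem blockCount_of_odd {D : ℕ} (hD : Odd D) (r : ℕ) :
    blockCount D r = 2 * ceilDiv r (2 * (D - 2)) :=
  if_neg (Nat.not_even_iff_odd.2 hD)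

/-- A letter with `ϱ_i = 0` (i.e. `i ∉ I`) carries no hypergraph (`⌈0/b⌉ = 0`; the tree's
`CPLine.ceilDiv_zero` is the same computation for an unrelated `ceilDiv`).
[cite: IkenmeyerKandasamy2019, §15] -/
@[simp] theorem blockCount_zero (D : ℕ) : blockCount D 0 = 0 := by
  have h : ∀ b, ceilDiv 0 b = 0 := fun b => by
    unfold ceilDiv
    rcases b with _ | b
    · simp
    · rw [Nat.zero_add, Nat.add_sub_cancel]
      exact Nat.div_eq_of_lt (Nat.lt_succ_self b)
  unfold blockCount; split_ifs <;> simp [h]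

/-- `e_ϱ = ∑ (blockCount D)` over the parts. [cite: IkenmeyerKandasamy2019, Thm. 4.2] -/
theorem eRho_eq_sum_blockCount (D : ℕ) (s : Multiset ℕ) :
    eRho D s = (s.map (blockCount D)).sum := by
  unfold eRho blockCount
  split_ifs <;> rfl

/-- `e_ϱ` of the padded composition `ϱ : [m] → ℕ` (the multiset `univ.val.map ϱ` of the named
fact) is `∑_i blockCount D ϱ_i`. [cite: IkenmeyerKandasamy2019, Thm. 13.1] -/
theorem eRho_map_eq_sum {m : ℕ} (D : ℕ) (ρ : Fin m → ℕ) :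
    eRho D (Finset.univ.val.map ρ) = ∑ i, blockCount D (ρ i) := by
  rw [eRho_eq_sum_blockCount, Multiset.map_map]
  rfl

/-- Even `D`: `e_ϱ = ∑_i ⌈ϱ_i/(D-2)⌉`. [cite: IkenmeyerKandasamy2019, Thm. 13.1] -/
theorem eRho_map_of_even {m D : ℕ} (hD : Even D) (ρ : Fin m → ℕ) :
    eRho D (Finset.univ.val.map ρ) = ∑ i, ceilDiv (ρ i) (D - 2) := by
  rw [eRho_map_eq_sum]
  simp only [blockCount_of_even hD]

/-- Odd `D`: `e_ϱ = ∑_i 2⌈ϱ_i/(2(D-2))⌉`. [cite: IkenmeyerKandasamy2019, Thm. 13.1] -/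
theorem eRho_map_of_odd {m D : ℕ} (hD : Odd D) (ρ : Fin m → ℕ) :
    eRho D (Finset.univ.val.map ρ) = ∑ i, 2 * ceilDiv (ρ i) (2 * (D - 2)) := by
  rw [eRho_map_eq_sum]
  simp only [blockCount_of_odd hD]

/-- **The descriptive alphabet** of the lifted tableau (§13, TeX L1196–1204, chunk
p0020.txt:L22–32; §15, chunk p0022): for each letter `i ∈ [m]` with `n_i` block edges and `ϱ_i`
more name edges than block edges in its hypergraph `H^{(i)}` (Def. 14.1 (5): `|E_Name| = |E_Block|
+ ϱ_i`), the NAME symbols `i_ℓ`, `ℓ < n_i + ϱ_i` (left summand, `⟨i, ℓ⟩`), and the BLOCK symbols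
`j_k^i`, `k < n_i`, `j ≠ i` (right summand, `⟨i, (k, j)⟩`). Letters with `ϱ_i = 0` (`i ∉ I`)
have `n_i = 0` and contribute no symbol. For odd `D` the same symbol set is used, the block
edges (hence the `k`) coming in pairs `k, k̄` (§19). An `abbrev`, so that `Fintype` and
`DecidableEq` are inferred. [cite: IkenmeyerKandasamy2019, §13] -/
abbrev LiftSym (m : ℕ) (n ρ : Fin m → ℕ) : Type :=
  (Σ i : Fin m, Fin (n i + ρ i)) ⊕ (Σ i : Fin m, Fin (n i) × {j : Fin m // j ≠ i})

namespace LiftSym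

variable {m : ℕ} {n ρ : Fin m → ℕ}

/-- The name symbol `i_ℓ`. [cite: IkenmeyerKandasamy2019, §13] -/
abbrev name (i : Fin m) (ℓ : Fin (n i + ρ i)) : LiftSym m n ρ :=
  Sum.inl ⟨i, ℓ⟩

/-- The block symbol `j_k^i` (`j ≠ i`). [cite: IkenmeyerKandasamy2019, §13] -/
abbrev block (i : Fin m) (k : Fin (n i)) (j : Fin m) (hj : j ≠ i) : LiftSym m n ρ :=
  Sum.inr ⟨i, (k, ⟨j, hj⟩)⟩

/-- The index `i` of the hypergraph `H^{(i)}` a symbol belongs to (`i(i_ℓ) = i`, `i(j_k^i) = i`;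
§15 "for every vertex `v` in any `H^{(i)}` we define `i(v) := i`"). [cite: IkenmeyerKandasamy2019, §15] -/
def owner : LiftSym m n ρ → Fin m
  | Sum.inl x => x.1
  | Sum.inr x => x.1

/-- **The letter map of property (3)**: `φ(i_ℓ) := i` and `φ(j_k^i) := j` (§17, proof of part (3),
chunk p0024.txt:L16). [cite: IkenmeyerKandasamy2019, §17] -/
def base : LiftSym m n ρ → Fin m
  | Sum.inl x => x.1
  | Sum.inr x => x.2.2.1

/-- `i(i_ℓ) = i`. [cite: IkenmeyerKandasamy2019, §15] -/
@[simp] theorem owner_name (i : Fin m) (ℓ : Fin (n i + ρ i)) : owner (name i ℓ : LiftSym m n ρ) = i :=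
  rfl

/-- `i(j_k^i) = i`. [cite: IkenmeyerKandasamy2019, §15] -/
@[simp] theorem owner_block (i : Fin m) (k : Fin (n i)) (j : Fin m) (hj : j ≠ i) :
    owner (block i k j hj : LiftSym m n ρ) = i := rfl

/-- `φ(i_ℓ) = i`. [cite: IkenmeyerKandasamy2019, §17] -/
@[simp] theorem base_name (i : Fin m) (ℓ : Fin (n i + ρ i)) : base (name i ℓ : LiftSym m n ρ) = i :=
  rfl

/-- `φ(j_k^i) = j`. [cite: IkenmeyerKandasamy2019, §17] -/
@[simp] theorem base_block (i : Fin m) (k : Fin (n i)) (j : Fin m) (hj : j ≠ i) :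
    base (block i k j hj : LiftSym m n ρ) = j := rfl

/-- A block symbol's letter differs from its hypergraph index. [cite: IkenmeyerKandasamy2019, §13] -/
theorem base_ne_owner_of_inr (x : Σ i : Fin m, Fin (n i) × {j : Fin m // j ≠ i}) :
    base (Sum.inr x : LiftSym m n ρ) ≠ owner (Sum.inr x : LiftSym m n ρ) :=
  x.2.2.2

/-- Every symbol is a name symbol or a block symbol (case analysis in the printed notation).
[cite: IkenmeyerKandasamy2019, §13] -/
theorem eq_name_or_eq_block (x : LiftSym m n ρ) :
    (∃ i ℓ, x = name i ℓ) ∨ ∃ i k j hj, x = block i k j hj := by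
  rcases x with ⟨i, ℓ⟩ | ⟨i, k, j, hj⟩
  · exact Or.inl ⟨i, ℓ, rfl⟩
  · exact Or.inr ⟨i, k, j, hj, rfl⟩

end LiftSym

/-- **Cardinality of the alphabet**: `∑_i (n_i + ϱ_i)` name symbols and `(m-1) ∑_i n_i` block
symbols, `m e + d` in total for `e = ∑ n_i`, `d = ∑ ϱ_i` (§13: "`δ := m e_ϱ + d`", TeX L1136).
[cite: IkenmeyerKandasamy2019, Thm. 13.1] -/
theorem card_liftSym {m : ℕ} (n ρ : Fin m → ℕ) :
    Fintype.card (LiftSym m n ρ) = m * ∑ i, n i + ∑ i, ρ i := by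
  rcases Nat.eq_zero_or_pos m with rfl | hm
  · simp
  · obtain ⟨k, rfl⟩ : ∃ k, m = k + 1 := ⟨m - 1, by omega⟩
    simp only [Fintype.card_sum, Fintype.card_sigma, Fintype.card_fin, Fintype.card_prod,
      ne_eq, Fintype.card_subtype_compl, Fintype.card_unique, Finset.sum_add_distrib]
    rw [← Finset.sum_mul, add_mul, mul_comm (k : ℕ)]
    simp only [Nat.add_sub_cancel, one_mul]
    ring

/-- **`|LiftSym| = δ`**: with `n_i = blockCount D ϱ_i` (Props. 14.2 / 18.3) the alphabet has exactly
`m e_ϱ + d` symbols. [cite: IkenmeyerKandasamy2019, Thm. 13.1] -/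
theorem card_liftSym_blockCount {m d : ℕ} (D : ℕ) (ρ : Fin m → ℕ) (hd : ∑ i, ρ i = d) :
    Fintype.card (LiftSym m (fun i => blockCount D (ρ i)) ρ) =
      m * eRho D (Finset.univ.val.map ρ) + d := by
  rw [card_liftSym, eRho_map_eq_sum, hd]

end IK2020

/-- **Successor interface, descriptive form.** `IK2020_thm_13_1` follows from a `LiftingWitness`
over the alphabet `LiftSym m (blockCount D ∘ ϱ) ϱ` for all data of the theorem (this is what
§§15–17 (even `D`) and §§19–21 (odd `D`) construct). [cite: IkenmeyerKandasamy2019, §13] -/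
theorem IK2020_thm_13_1_of_forall_exists_liftSym_witness
    (H : ∀ (D m d : ℕ), 3 ≤ D → 2 ≤ m →
      (Odd D → 2 * (m - 1) ≤ Nat.choose (2 * (D - 1)) (D - 1)) →
      ∀ (S : ColTableau (Fin m)), S.IsShape m (d * D) → S.IsRegular →
      ∀ (ρ : Fin m → ℕ), Antitone ρ → ∑ i, ρ i = d → (∀ i, S.count i = D * ρ i) →
        ∃ (L : Fin (eRho D (Finset.univ.val.map ρ) * D) → Fin m →
            LiftSym m (fun i => blockCount D (ρ i)) ρ)
          (R : (c : Fin S.C) → Fin (S.h c) → LiftSym m (fun i => blockCount D (ρ i)) ρ),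
          LiftingWitness D S L R) :
    IK2020_thm_13_1 :=
  IK2020_thm_13_1_of_forall_exists_witness fun D m d hD hm hodd S hS hreg ρ hρ hsum hcnt => by
    obtain ⟨L, R, hW⟩ := H D m d hD hm hodd S hS hreg ρ hρ hsum hcnt
    exact ⟨_, inferInstance, inferInstance, L, R, card_liftSym_blockCount D ρ hsum, hW⟩

/-! ## §D  The corner `d = 0` -/

/-- **Thm. 13.1 for `d = 0`** (the typed fact allows `d = 0`; then `ϱ = 0`, `S` has no box,
`e_ϱ = 0`, `E = 0`, `δ = 0`, and the unique (empty) pair `(L, R)` is a witness).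
[cite: IkenmeyerKandasamy2019, Thm. 13.1] -/
theorem IK2020_thm_13_1_of_d_eq_zero (D m d : ℕ) (hm : 2 ≤ m) (S : ColTableau (Fin m))
    (hS : S.IsShape m (d * D)) (ρ : Fin m → ℕ) (hsum : ∑ i, ρ i = d) (hd : d = 0) :
    ∃ (L : Fin (eRho D (Finset.univ.val.map ρ) * D) → Fin m →
        Fin (m * eRho D (Finset.univ.val.map ρ) + d))
      (R : (c : Fin S.C) → Fin (S.h c) → Fin (m * eRho D (Finset.univ.val.map ρ) + d)),
      LiftingWitness D S L R := by
  subst hd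
  have hρ : ∀ i, ρ i = 0 := fun i => by
    have := Finset.single_le_sum (fun j _ => Nat.zero_le (ρ j)) (Finset.mem_univ i)
    omega
  have he : eRho D (Finset.univ.val.map ρ) = 0 := by
    rw [eRho_map_eq_sum]
    exact Finset.sum_eq_zero fun i _ => by rw [hρ i, blockCount_zero]
  have hC : S.C = 0 := ColTableau.C_eq_zero_of_isShape_zero (by simpa using hS)
  have hδ : m * eRho D (Finset.univ.val.map ρ) + 0 = 0 := by rw [he, mul_zero]
  have hE : eRho D (Finset.univ.val.map ρ) * D = 0 := by rw [he, zero_mul]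
  haveI : IsEmpty (Fin (m * eRho D (Finset.univ.val.map ρ) + 0)) := ⟨fun u => (Fin.cast hδ u).elim0⟩
  exact ⟨fun c => (Fin.cast hE c).elim0, fun c => (Fin.cast hC c).elim0,
    LiftingWitness.of_isEmpty (by omega) hC _ _⟩

end Literature.Computability.AlgebraicComplexity
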